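import Mathlib.Analysis.Complex.Liouville

/-!
# PORT PT-B (U8), g4 file 3 — ROAD (2) «FORMULA-FREE» MADE TRANSFER-FREE: ★ `weighted_le_of_two_approx_fixedPoints` (two approximate fixed points of ONE weighted-sup
# contraction are close — no completeness, no fixed point, no metric instance), ★★ `weighted_twoVolume_of_caps_transport` (the SINGLE-CHAIN MAP-DEFECT composition: caps
# at one configuration per member + exact lift-conjugacy of the window map ⇒ the two members' window read-outs agree in the weighted currency), ★ `norm_deriv_sub_deriv_le_of_sphere`
# + ★★ `deriv_twoVolume_of_caps_transport` (∘ Cauchy for a difference: the RESPONSES — derivatives at `0` along the complex source line — agree to `((ε+ε′)∕(1−K))∕R`)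

Cell `ym-nodeO-ideate` ∕ `ym-balaban-port`, porter `ymgap-nodeO-port-PTB-1` (gen 4).  JOIN-side helper for the decay road of **stmt-QuantumFields-27238** (K0ᴬ),
`--supports stmt-QuantumFields-27238 --as helper`; ★★★ director-ym №509 (iii′) («the (Φ-cmp) single-chain MAP-DEFECT chain feeding lens-1's `response_twoVolume_formulaFree`
§11 road, as a JOIN-side helper over displayed (11′)(12ℂ)(Φ-cmp)»).  [I] = [Balaban1987RG1], [15] = [Balaban1985Variational], [B6] = [Balaban1984PropagatorsII].

WHY TRANSFER-FREE.  ◇ lens-1's §11 (`nodeO-cover/LENS-1-D4VolumeCauchy-v1.6.lean`, HOME sketch) reads (R4ᴰ)′ off `ContractingWith.dist_fixedPoint_le` with a transfer map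
`P : X′ → X` between the two members' (115)-carriers.  At the record the carriers are ABSTRACT (`Node00/BackgroundMapOfRecord.BgScheme`: `𝒴` with a one-way PRESENTATION
`ev : 𝒴 →ₗ (bonds → M_N(ℂ))`), so no such `P` exists; what exists are READ-OUTS of both members on a common window (bond functions) and the centred lift of the window.
This file therefore phrases road (2) on read-outs only: one window map `fW` on the small member's window functions (a weighted-sup contraction of ratio `K` on a set `S`),
its lift-conjugate `fW′` on the big member's window functions (EXACT transport `(fW′ u′) ∘ lift = fW (u′ ∘ lift)` — the map-level form of ✓`windowResp_liftBondCtr` ∕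
✓`isCritical_extend_liftBondCtr`), and per member ONE cap at ONE configuration («the window map reproduces the read-out of the member's solution up to `ε` in the weighted
currency» — (Φ-cap), the single-chain class ◆ CRIT-1 calls true-shaped).  Weights `w ≥ 0` (typically `e^{−δ′·dist(·, core)}`, `= 1` on the core) make the rim of the window,
where caps are `O(1)`, harmless.  NO formula for any response, NO Landau representative, NO (182), NO `χ_l`, NO selector; nothing lattice-specific — pure bookkeeping over
displayed hypotheses, instance-free and definition-free.

WHAT IS PROVED (kernel, sorry-free; Mathlib only).
§1 ★ `weighted_le_of_two_approx_fixedPoints` — `f` a weighted-sup contraction of ratio `K < 1` on `S ⊆ (ι → V)` (`ι` finite), `r, r′ ∈ S` with `w·‖f r − r‖ ≤ ε`,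
   `w·‖f r′ − r′‖ ≤ ε′` pointwise ⟹ `w·‖r − r′‖ ≤ (ε + ε′)∕(1 − K)` pointwise (max over the finite index set + the triangle inequality; `r, r′` need not be fixed points of
   anything and `f` need not have one).  `approx_of_readout_cap` — how (Φ-cap) at the member's solution produces the premise.
§2 ★★ `weighted_twoVolume_of_caps_transport` — members `n` (window `ι`), `n+1` (window `ι′`), `lift : ι → ι′`; exact transport of the window maps on `S′`; caps `ε`, `ε′`;
   pull-back of `S′` inside `S` ⟹ `w i·‖r i − r′ (lift i)‖ ≤ (ε + ε′)∕(1 − K)` for every `i`; `twoVolume_core_of_caps_transport` — on indices with `1 ≤ w i` the bare norm bound.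
§3 ★ `norm_deriv_sub_deriv_le_of_sphere` (Cauchy for a difference along a complex line, Mathlib `Complex.norm_deriv_le_of_forall_mem_sphere_norm_le`) and
   ★★ `deriv_twoVolume_of_caps_transport` — if §2's hypotheses hold at every source strength `t` on the circle `|t| = R` (uniform `ε, ε′, K`) and the two core read-outs are
   complex-differentiable on the disc and continuous on its closure ((12ℂ), DISPLAYED), the RESPONSES differ by at most `((ε + ε′)∕(1 − K))∕R` at every core index.

HONEST FRAMING.  Generic helpers; every analytic input ((11′) contraction of the window map, (Φ-cap) per member, (12ℂ)) is a displayed hypothesis of the theorems, asserted by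
nobody; nothing of Bałaban's analysis is asserted ∕ ported ∕ discharged; (R4ᴰ)′, D4, K0ᴬ 27238 UNPROVED ∕ OPEN; NODE O 0∕1; COUNT 8∕28 · K 1∕4 UNMOVED; finite `𝕋⁴_{L^K}` at
fixed ε — NOT continuum ∕ OS ∕ Clay; **the Yang–Mills mass gap (Clay) is NOT proved by any of this.**
-/

open Metric Set

namespace Summit.QuantumFields.YangMills.Theorems.PortU8

section ApproxFixedPoints

variable {ι : Type*} [Fintype ι] {V : Type*} [NormedAddCommGroup V]

/-- ★ **TWO APPROXIMATE FIXED POINTS OF ONE WEIGHTED-SUP CONTRACTION ARE CLOSE.**  `f` contracts the weighted sup-seminorm `u ↦ max_i w i·‖u i‖` (`w ≥ 0`) by the ratio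
`K < 1` on `S`; if `r, r′ ∈ S` are `ε`- resp. `ε′`-approximate fixed points in that currency, then `w i·‖r i − r′ i‖ ≤ (ε + ε′)∕(1 − K)` for every `i`.  No completeness, no
fixed point of `f`, no metric-space instance is used: the maximum over the finite index set and the triangle inequality.
[cite: Copson1968, §80 (contraction bookkeeping); Balaban1985Variational, Prop. 6 (119)–(120) p.295] -/
theorem weighted_le_of_two_approx_fixedPoints (w : ι → ℝ) (hw : ∀ i, 0 ≤ w i) (S : Set (ι → V)) (f : (ι → V) → (ι → V)) {K : ℝ} (hK : K < 1)
    (hf : ∀ u ∈ S, ∀ v ∈ S, ∀ c : ℝ, (∀ i, w i * ‖u i - v i‖ ≤ c) → ∀ i, w i * ‖f u i - f v i‖ ≤ K * c)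
    {r r' : ι → V} (hr : r ∈ S) (hr' : r' ∈ S) {ε ε' : ℝ}
    (hε : ∀ i, w i * ‖f r i - r i‖ ≤ ε) (hε' : ∀ i, w i * ‖f r' i - r' i‖ ≤ ε') (i : ι) :
    w i * ‖r i - r' i‖ ≤ (ε + ε') / (1 - K) := by
  classical
  have hK1 : 0 < 1 - K := sub_pos.2 hK
  -- the maximum `M` of the weighted differences over the finite index set
  obtain ⟨i₀, -, hi₀⟩ := Finset.exists_max_image Finset.univ (fun j => w j * ‖r j - r' j‖) ⟨i, Finset.mem_univ i⟩
  set M : ℝ := w i₀ * ‖r i₀ - r' i₀‖ with hM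
  have hle : ∀ j, w j * ‖r j - r' j‖ ≤ M := fun j => hi₀ j (Finset.mem_univ j)
  have hε0 : 0 ≤ ε := le_trans (mul_nonneg (hw i₀) (norm_nonneg _)) (hε i₀)
  have hε0' : 0 ≤ ε' := le_trans (mul_nonneg (hw i₀) (norm_nonneg _)) (hε' i₀)
  -- `M ≤ ε + K·M + ε′`
  have hfM : w i₀ * ‖f r i₀ - f r' i₀‖ ≤ K * M := hf r hr r' hr' M hle i₀
  have htri : ‖r i₀ - r' i₀‖ ≤ ‖f r i₀ - r i₀‖ + ‖f r i₀ - f r' i₀‖ + ‖f r' i₀ - r' i₀‖ := by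
    have h1 : r i₀ - r' i₀ = -(f r i₀ - r i₀) + (f r i₀ - f r' i₀) + (f r' i₀ - r' i₀) := by abel
    rw [h1]
    refine (norm_add_le _ _).trans (add_le_add ((norm_add_le _ _).trans (add_le_add (le_of_eq (norm_neg _)) le_rfl)) le_rfl)
  have hMle : M ≤ ε + K * M + ε' := by
    have := mul_le_mul_of_nonneg_left htri (hw i₀)
    rw [mul_add, mul_add] at this
    linarith [hε i₀, hε' i₀]
  have hMbound : M ≤ (ε + ε') / (1 - K) := by
    rw [le_div_iff₀ hK1]; nlinarith
  exact (hle i).trans hMbound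

omit [Fintype ι] in
/-- **HOW (Φ-cap) FEEDS §1**: if `r` is the window read-out of a configuration `A` with `T A = A` (the member's solution) — `r = ρ (T A)` — and the window map reproduces the
read-out of `T A` from the read-out of `A` up to `ε` (the map-level window cap at ONE configuration), then `r` is an `ε`-approximate fixed point of the window map.
[cite: Balaban1987RG1, p.290 L17–20 (window comparison); Balaban1985Variational, Thm 1 p.279] -/
theorem approx_of_readout_cap {X : Type*} (w : ι → ℝ) (ρ : X → (ι → V)) (T : X → X) (fW : (ι → V) → (ι → V)) {A : X} (hA : T A = A) {ε : ℝ}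
    (hcap : ∀ i, w i * ‖ρ (T A) i - fW (ρ A) i‖ ≤ ε) (i : ι) :
    w i * ‖fW (ρ A) i - ρ A i‖ ≤ ε := by
  have h := hcap i
  rwa [hA, ← norm_neg, neg_sub] at h

end ApproxFixedPoints

section TwoVolume

variable {ι ι' : Type*} [Fintype ι] {V : Type*} [NormedAddCommGroup V]

/-- ★★ **THE SINGLE-CHAIN MAP-DEFECT COMPOSITION (two members).**  Window map `fW` of member `n` (weighted-sup contraction of ratio `K` on `S`), window map `fW′` of member
`n+1`, EXACTLY lift-conjugate on `S′` (`(fW′ u′) ∘ lift = fW (u′ ∘ lift)` — window transport, zero defect under the no-wrap guard), pull-backs of `S′` inside `S`; read-outs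
`r ∈ S` (member `n`) and `r′ ∈ S′` (member `n+1`) that the respective window maps reproduce up to `ε`, `ε′` (caps at ONE configuration each, the cap of member `n+1` read at
the lifted indices with the SAME weights).  Then `w i·‖r i − r′ (lift i)‖ ≤ (ε + ε′)∕(1 − K)` at every index — the two-volume comparison with NO closed form for either read-out.
[cite: Balaban1987RG1, (1.21) p.264, p.290 L17–20; Balaban1985Variational, Thm 1 p.279, Prop. 6 p.295] -/
theorem weighted_twoVolume_of_caps_transport (w : ι → ℝ) (hw : ∀ i, 0 ≤ w i) (lift : ι → ι') (S : Set (ι → V)) (S' : Set (ι' → V))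
    (fW : (ι → V) → (ι → V)) (fW' : (ι' → V) → (ι' → V)) {K : ℝ} (hK : K < 1)
    (hf : ∀ u ∈ S, ∀ v ∈ S, ∀ c : ℝ, (∀ i, w i * ‖u i - v i‖ ≤ c) → ∀ i, w i * ‖fW u i - fW v i‖ ≤ K * c)
    (hT : ∀ u' ∈ S', (fun i => fW' u' (lift i)) = fW (fun i => u' (lift i)))
    (hS : ∀ u' ∈ S', (fun i => u' (lift i)) ∈ S)
    {r : ι → V} {r' : ι' → V} (hr : r ∈ S) (hr' : r' ∈ S') {ε ε' : ℝ}
    (hε : ∀ i, w i * ‖fW r i - r i‖ ≤ ε) (hε' : ∀ i, w i * ‖fW' r' (lift i) - r' (lift i)‖ ≤ ε') (i : ι) :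
    w i * ‖r i - r' (lift i)‖ ≤ (ε + ε') / (1 - K) := by
  have hpull : ∀ j, w j * ‖fW (fun i => r' (lift i)) j - r' (lift j)‖ ≤ ε' := fun j => by
    have h := hε' j
    rwa [show fW' r' (lift j) = fW (fun i => r' (lift i)) j from congrFun (hT r' hr') j] at h
  exact weighted_le_of_two_approx_fixedPoints w hw S fW hK hf hr (hS r' hr') hε hpull i

/-- **On the core (weight `≥ 1`) the bare two-volume bound.** [cite: Balaban1987RG1, (1.21) p.264] -/
theorem twoVolume_core_of_caps_transport (w : ι → ℝ) (hw : ∀ i, 0 ≤ w i) (lift : ι → ι') (S : Set (ι → V)) (S' : Set (ι' → V))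
    (fW : (ι → V) → (ι → V)) (fW' : (ι' → V) → (ι' → V)) {K : ℝ} (hK : K < 1)
    (hf : ∀ u ∈ S, ∀ v ∈ S, ∀ c : ℝ, (∀ i, w i * ‖u i - v i‖ ≤ c) → ∀ i, w i * ‖fW u i - fW v i‖ ≤ K * c)
    (hT : ∀ u' ∈ S', (fun i => fW' u' (lift i)) = fW (fun i => u' (lift i)))
    (hS : ∀ u' ∈ S', (fun i => u' (lift i)) ∈ S)
    {r : ι → V} {r' : ι' → V} (hr : r ∈ S) (hr' : r' ∈ S') {ε ε' : ℝ}
    (hε : ∀ i, w i * ‖fW r i - r i‖ ≤ ε) (hε' : ∀ i, w i * ‖fW' r' (lift i) - r' (lift i)‖ ≤ ε') {i : ι} (hi : 1 ≤ w i) :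
    ‖r i - r' (lift i)‖ ≤ (ε + ε') / (1 - K) := by
  have h := weighted_twoVolume_of_caps_transport w hw lift S S' fW fW' hK hf hT hS hr hr' hε hε' i
  have h1 : ‖r i - r' (lift i)‖ ≤ w i * ‖r i - r' (lift i)‖ := by
    simpa using mul_le_mul_of_nonneg_right hi (norm_nonneg (r i - r' (lift i)))
  exact h1.trans h

end TwoVolume

section Cauchy

variable {W : Type*} [NormedAddCommGroup W] [NormedSpace ℂ W]

/-- ★ **CAUCHY FOR A DIFFERENCE along a complex line**: `f, g : ℂ → W` complex-differentiable on `ball 0 R` and continuous on its closure with `‖f t − g t‖ ≤ η` on the circle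
`|t| = R` ⟹ `‖f′(0) − g′(0)‖ ≤ η ∕ R`. [cite: Balaban1987RG1, (4.37) p.290 (Cauchy bounds in the analyticity domain); Balaban1985Variational, Prop. 9 p.309] -/
theorem norm_deriv_sub_deriv_le_of_sphere {f g : ℂ → W} {R η : ℝ} (hR : 0 < R)
    (hf : DiffContOnCl ℂ f (ball 0 R)) (hg : DiffContOnCl ℂ g (ball 0 R)) (hη : ∀ t ∈ sphere (0 : ℂ) R, ‖f t - g t‖ ≤ η) :
    ‖deriv f 0 - deriv g 0‖ ≤ η / R := by
  have hfd : DifferentiableAt ℂ f 0 := hf.differentiableAt isOpen_ball (mem_ball_self hR)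
  have hgd : DifferentiableAt ℂ g 0 := hg.differentiableAt isOpen_ball (mem_ball_self hR)
  rw [← deriv_sub hfd hgd]
  exact Complex.norm_deriv_le_of_forall_mem_sphere_norm_le hR (hf.sub hg) (by simpa using hη)

variable {ι ι' : Type*} [Fintype ι]

/-- ★★ **THE RESPONSES' TWO-VOLUME COMPARISON, FORMULA-FREE AND TRANSFER-FREE.**  Along the complex source line `t ↦` (read-outs of the two members' solutions at source strength
`t`): if at every `t` on the circle `|t| = R` the hypotheses of ✓`weighted_twoVolume_of_caps_transport` hold with uniform `K, ε, ε′` (window maps `fW t`, `fW′ t` lift-conjugate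
on `S′`, contraction of ratio `K` on `S`, caps at the two solutions' read-outs `r t ∈ S`, `r′ t ∈ S′`), and at a core index `i` (`1 ≤ w i`) both coordinate read-outs are
complex-differentiable on the disc and continuous on its closure ((12ℂ) — DISPLAYED), then the RESPONSES (derivatives at `0`) satisfy
`‖(r · i)′(0) − (r′ · (lift i))′(0)‖ ≤ ((ε + ε′)∕(1 − K))∕R`.  No closed form, no Landau representative, no (182), no selector.
[cite: Balaban1987RG1, (1.21) p.264, (4.35)–(4.37) p.290; Balaban1985Variational, Thm 1 p.279, Prop. 9 p.309] -/
theorem deriv_twoVolume_of_caps_transport {V : Type*} [NormedAddCommGroup V] [NormedSpace ℂ V]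
    (w : ι → ℝ) (hw : ∀ i, 0 ≤ w i) (lift : ι → ι') (S : Set (ι → V)) (S' : Set (ι' → V))
    (fW : ℂ → (ι → V) → (ι → V)) (fW' : ℂ → (ι' → V) → (ι' → V)) {K R : ℝ} (hK : K < 1) (hR : 0 < R)
    (hf : ∀ t ∈ sphere (0 : ℂ) R, ∀ u ∈ S, ∀ v ∈ S, ∀ c : ℝ, (∀ i, w i * ‖u i - v i‖ ≤ c) → ∀ i, w i * ‖fW t u i - fW t v i‖ ≤ K * c)
    (hT : ∀ t ∈ sphere (0 : ℂ) R, ∀ u' ∈ S', (fun i => fW' t u' (lift i)) = fW t (fun i => u' (lift i)))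
    (hS : ∀ u' ∈ S', (fun i => u' (lift i)) ∈ S)
    (r : ℂ → (ι → V)) (r' : ℂ → (ι' → V)) (hr : ∀ t ∈ sphere (0 : ℂ) R, r t ∈ S) (hr' : ∀ t ∈ sphere (0 : ℂ) R, r' t ∈ S') {ε ε' : ℝ}
    (hε : ∀ t ∈ sphere (0 : ℂ) R, ∀ i, w i * ‖fW t (r t) i - r t i‖ ≤ ε) (hε' : ∀ t ∈ sphere (0 : ℂ) R, ∀ i, w i * ‖fW' t (r' t) (lift i) - r' t (lift i)‖ ≤ ε')
    {i : ι} (hi : 1 ≤ w i)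
    (hd : DiffContOnCl ℂ (fun t => r t i) (ball 0 R)) (hd' : DiffContOnCl ℂ (fun t => r' t (lift i)) (ball 0 R)) :
    ‖deriv (fun t => r t i) 0 - deriv (fun t => r' t (lift i)) 0‖ ≤ ((ε + ε') / (1 - K)) / R :=
  norm_deriv_sub_deriv_le_of_sphere hR hd hd' fun t ht =>
    twoVolume_core_of_caps_transport w hw lift S S' (fW t) (fW' t) hK (hf t ht) (hT t ht) hS (hr t ht) (hr' t ht) (hε t ht) (hε' t ht) hi

end Cauchy

end Summit.QuantumFields.YangMills.Theorems.PortU8
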